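import Literature.NumberTheory.Automorphic.GL2CentralCharacter
import Literature.NumberTheory.Automorphic.GL2AdelicWeightVectors
import HarnessLib

/-!
# `Z(𝔤)`-finiteness of a function on `GL₂(𝔸_ℚ)` from its Casimir and central eigenvalues

Topic `NumberTheory/Automorphic`; theorems only (no definition, no named fact; D-0026). One of the
defining properties of an automorphic form `φ` on `GL₂(𝔸_ℚ)` (Borel–Jacquet 1979, 4.2 (c)) is
`Z(𝔤)`-finiteness (`IsZFinite`, for the archimedean group `GL₂(ℚ_∞)` of the automorphy datum
`AutomorphyDatum.gl 2 ℚ hcpt`). Since `Z(U(𝔤𝔩₂)) = ℂ[Z, C]` (Bump 1997, §2.2; tree: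
`GL2Casimir.lift_center_apply_eq_smul_of_casimir_of_zed`, `GL2CentralCharacter`), an
archimedean-smooth `φ` on which the Casimir operator `C = ∑_{a,b} E_{ab} E_{ba}` and the centre
`Z = 1 ∈ 𝔤𝔩₂(ℝ)` act by scalars — e.g. the adelic lift of a holomorphic cusp form of weight `k`
(`C = (k-1)²/2 - ½ + ½·0`, `Z = 0`) — has a full `Z(𝔤)`-character (`HasZCharacter`), hence is
`Z(𝔤)`-finite. This file proves exactly that, with `C` and `Z` written as (iterated) Lie
derivatives along `ι_𝔸 : GL₂(ℝ) → GL₂(𝔸_ℚ)` (`Rat.iotaA`, the calculus of `GL2WeightVectors` /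
`GL2AdelicWeightVectors`) and the `Z(𝔤)`-action of the datum
(`ArchimedeanCalculus.applyFree`, central words):

* `UEnv.lift_comp_map`, `UEnv.map_map_symm`, `UEnv.map_symm_mem_center` — functoriality of the
  universal enveloping algebra along a Lie algebra isomorphism (the induced algebra map
  `U(e) = lift (ι ∘ e)`, its inverse, centres, naturality of `lift`);
* `Rat.exists_lieEquiv_lieOfReal` — `𝔤𝔩₂(ℝ) ≃ₗ⁅ℝ⁆ 𝔤𝔩₂(ℚ_∞)` (`= ⊤ ≤ 𝔤𝔩₂(mixedSpace ℚ)`)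
  extending `X ↦ X ⊗ 1 = Rat.lieOfReal hcpt X` (`ℚ` has one infinite place, real);
* `Rat.hasZCharacter_of_casimir_of_zed`, `Rat.isZFinite_of_casimir_of_zed` — the theorem: for
  `φ : GL₂(𝔸_ℚ) → ℂ` smooth in the archimedean variable with
  `∑_{a,b} E_{ab}(E_{ba} φ) = (s₁² + s₂² - ½) φ` and `Z φ = (s₁ + s₂) φ` along `ι_𝔸`, `Z(𝔤)` acts on
  `φ` through a character; in particular `φ` is `Z(𝔤)`-finite.

## References

* A. Borel, H. Jacquet, *Automorphic forms and automorphic representations*, Corvallis 1979,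
  §1.5–1.6, 4.2 (c). [BorelJacquet1979]
* D. Bump, *Automorphic Forms and Representations* (1997), §2.2, §3.2 (PDF p. 292). [Bump1997]
* A. W. Knapp, *Lie Groups Beyond an Introduction* (2002), §III.1–3 (`U(𝔤)`), Thm. 5.44. [Knapp2002]
-/

noncomputable section

-- Mathlib idiom (Mathlib/Algebra/Lie/OfAssociative.lean), as in the `GL2*`/`HarishChandraGL*` files:
-- the Lie bracket on matrix algebras is the commutator.
attribute [local instance 100] LieRing.ofAssociativeRing

open scoped MatrixGroups Matrix Classical
open UniversalEnvelopingAlgebra NumberField NumberField.mixedEmbedding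

namespace Literature.NumberTheory.Automorphic

open HCSpan

/-! ### Functoriality of `U(𝔤)` along a Lie algebra isomorphism -/

namespace UEnv

variable {R : Type*} [CommRing R] {L L' : Type*} [LieRing L] [LieAlgebra R L] [LieRing L'] [LieAlgebra R L']

/-- **Naturality of `lift`**: for a Lie algebra map `e : L → L'` and a representation `ρ` of `L'`,
`lift ρ ∘ U(e) = lift (ρ ∘ e)`, `U(e) = lift (ι ∘ e) : U(L) → U(L')` (both sides agree on `ι(L)`).
Dixmier, *Enveloping Algebras*, 2.1.1–2.2. [folklore] -/
theorem lift_comp_map (e : L →ₗ⁅R⁆ L') {A : Type*} [Ring A] [Algebra R A] (ρ : L' →ₗ⁅R⁆ A) :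
    (lift R ρ).comp (lift R ((UniversalEnvelopingAlgebra.ι R).comp e)) = lift R (ρ.comp e) := by
  apply UniversalEnvelopingAlgebra.hom_ext
  refine LieHom.ext fun X ↦ ?_
  change lift R ρ (lift R ((UniversalEnvelopingAlgebra.ι R).comp e) (UniversalEnvelopingAlgebra.ι R X)) =
    lift R (ρ.comp e) (UniversalEnvelopingAlgebra.ι R X)
  rw [lift_ι_apply, LieHom.comp_apply, lift_ι_apply, lift_ι_apply, LieHom.comp_apply]

/-- `U(e) ∘ U(e⁻¹) = id` for a Lie algebra isomorphism `e`. Dixmier 2.1.1. [folklore] -/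
theorem map_map_symm (e : L ≃ₗ⁅R⁆ L') (u : UniversalEnvelopingAlgebra R L') :
    lift R ((UniversalEnvelopingAlgebra.ι R).comp e.toLieHom)
      (lift R ((UniversalEnvelopingAlgebra.ι R).comp e.symm.toLieHom) u) = u := by
  have h : (lift R ((UniversalEnvelopingAlgebra.ι R).comp e.toLieHom)).comp
      (lift R ((UniversalEnvelopingAlgebra.ι R).comp e.symm.toLieHom)) = AlgHom.id R _ := by
    apply UniversalEnvelopingAlgebra.hom_ext
    refine LieHom.ext fun X ↦ ?_
    change lift R ((UniversalEnvelopingAlgebra.ι R).comp e.toLieHom)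
      (lift R ((UniversalEnvelopingAlgebra.ι R).comp e.symm.toLieHom) (UniversalEnvelopingAlgebra.ι R X)) =
      UniversalEnvelopingAlgebra.ι R X
    rw [lift_ι_apply, LieHom.comp_apply, LieEquiv.coe_toLieHom, lift_ι_apply, LieHom.comp_apply,
      LieEquiv.coe_toLieHom, LieEquiv.apply_symm_apply]
  exact AlgHom.congr_fun h u

/-- `U(e⁻¹) ∘ U(e) = id` for a Lie algebra isomorphism `e`. Dixmier 2.1.1. [folklore] -/
theorem map_symm_map (e : L ≃ₗ⁅R⁆ L') (u : UniversalEnvelopingAlgebra R L) :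
    lift R ((UniversalEnvelopingAlgebra.ι R).comp e.symm.toLieHom)
      (lift R ((UniversalEnvelopingAlgebra.ι R).comp e.toLieHom) u) = u := by
  have h := map_map_symm e.symm u
  simpa only [LieEquiv.symm_symm] using h

/-- `U(e⁻¹)` maps the centre of `U(L')` into the centre of `U(L)` (an isomorphism preserves
commutation). Dixmier 2.1.1. [folklore] -/
theorem map_symm_mem_center (e : L ≃ₗ⁅R⁆ L') {u : UniversalEnvelopingAlgebra R L'}
    (hu : u ∈ Subalgebra.center R (UniversalEnvelopingAlgebra R L')) :
    lift R ((UniversalEnvelopingAlgebra.ι R).comp e.symm.toLieHom) u ∈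
      Subalgebra.center R (UniversalEnvelopingAlgebra R L) := by
  rw [Subalgebra.mem_center_iff] at hu ⊢
  intro x
  -- `x = U(e⁻¹) (U(e) x)`
  have hx : x = lift R ((UniversalEnvelopingAlgebra.ι R).comp e.symm.toLieHom)
      (lift R ((UniversalEnvelopingAlgebra.ι R).comp e.toLieHom) x) := (map_symm_map e x).symm
  rw [hx, ← map_mul, ← map_mul, hu]

end UEnv

/-! ### `𝔤𝔩₂(ℝ) ≃ 𝔤𝔩₂(ℚ_∞)` -/

section RatArch

variable {hcpt : isCompact_glFiniteIntegralLevel 2 ℚ}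

/-- `ℚ` has no complex place. [folklore] -/
theorem Rat.isEmpty_isComplex_infinitePlace : IsEmpty {w : InfinitePlace ℚ // w.IsComplex} :=
  ⟨fun w ↦ InfinitePlace.not_isReal_iff_isComplex.mpr w.2
    (by rw [Subsingleton.elim w.1 Rat.infinitePlace]; exact Rat.isReal_infinitePlace)⟩

/-- **`ℝ ≃ ℚ_∞ = mixedSpace ℚ` as real algebras**: the structure map `ℝ → mixedSpace ℚ` is
bijective (`ℚ` has exactly one infinite place, which is real). [folklore] -/
theorem Rat.bijective_algebraMap_mixedSpace :
    Function.Bijective (algebraMap ℝ (mixedSpace ℚ)) := by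
  haveI := Rat.isEmpty_isComplex_infinitePlace
  let w₀ : {w : InfinitePlace ℚ // w.IsReal} := ⟨Rat.infinitePlace, Rat.isReal_infinitePlace⟩
  constructor
  · intro a b h
    have := congrArg (fun x : mixedSpace ℚ ↦ x.1 w₀) h
    simpa using this
  · intro x
    refine ⟨x.1 w₀, Prod.ext (funext fun w ↦ ?_) (funext fun w ↦ isEmptyElim w)⟩
    have hw : w = w₀ := Subsingleton.elim _ _
    subst hw
    simp [Pi.algebraMap_apply]

variable (hcpt) in
/-- **`𝔤𝔩₂(ℝ) ≃ₗ⁅ℝ⁆ 𝔤𝔩₂(ℚ_∞)`**: a real Lie algebra isomorphism from `𝔤𝔩₂(ℝ)` onto the Lie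
algebra `⊤ ≤ 𝔤𝔩₂(mixedSpace ℚ)` of the archimedean group of the `GL₂/ℚ` automorphy datum,
extending `X ↦ X ⊗ 1 = Rat.lieOfReal hcpt X` (entrywise `ℝ ≃ mixedSpace ℚ`, then
`LieSubalgebra.topEquiv`). [folklore] -/
theorem Rat.exists_lieEquiv_lieOfReal :
    ∃ e : Matrix (Fin 2) (Fin 2) ℝ ≃ₗ⁅ℝ⁆ (AutomorphyDatum.gl 2 ℚ hcpt).arch.lie,
      ∀ X, e X = Rat.lieOfReal hcpt X := by
  let a : ℝ ≃ₐ[ℝ] mixedSpace ℚ :=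
    AlgEquiv.ofBijective (Algebra.ofId ℝ (mixedSpace ℚ)) Rat.bijective_algebraMap_mixedSpace
  let e₁ : Matrix (Fin 2) (Fin 2) ℝ ≃ₗ⁅ℝ⁆ Matrix (Fin 2) (Fin 2) (mixedSpace ℚ) :=
    (a.mapMatrix : Matrix (Fin 2) (Fin 2) ℝ ≃ₐ[ℝ] Matrix (Fin 2) (Fin 2) (mixedSpace ℚ)).toLieEquiv
  let e₂ : (⊤ : LieSubalgebra ℝ (Matrix (Fin 2) (Fin 2) (mixedSpace ℚ))) ≃ₗ⁅ℝ⁆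
      Matrix (Fin 2) (Fin 2) (mixedSpace ℚ) := LieSubalgebra.topEquiv
  refine ⟨e₁.trans e₂.symm, fun X ↦ ?_⟩
  apply Subtype.ext
  change ((e₂.symm (e₁ X) : (⊤ : LieSubalgebra ℝ (Matrix (Fin 2) (Fin 2) (mixedSpace ℚ)))) :
      Matrix (Fin 2) (Fin 2) (mixedSpace ℚ)) = X.map (algebraMap ℝ (mixedSpace ℚ))
  rw [show ((e₂.symm (e₁ X) : (⊤ : LieSubalgebra ℝ (Matrix (Fin 2) (Fin 2) (mixedSpace ℚ)))) :
      Matrix (Fin 2) (Fin 2) (mixedSpace ℚ)) = e₁ X from rfl]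
  rfl

end RatArch

/-! ### `Z(𝔤)`-character and `Z(𝔤)`-finiteness from the Casimir and central eigenvalues -/

section Main

variable {hcpt : isCompact_glFiniteIntegralLevel 2 ℚ}

open GL2Real GLnCasimir

set_option maxHeartbeats 1600000 in
/-- **A smooth function on `GL₂(𝔸_ℚ)` with Casimir and central eigenvalues has a
`Z(𝔤)`-character.** Let `φ : GL₂(𝔸_ℚ) → ℂ` be smooth in the archimedean variable of the `GL₂/ℚ`
automorphy datum and suppose that along `ι_𝔸 : GL₂(ℝ) → GL₂(𝔸_ℚ)`
`∑_{a,b} E_{ab}(E_{ba} φ) = (s₁² + s₂² - ½) φ` (the Casimir `C = Ω + ½ Z²` of `𝔤𝔩₂`,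
`GL2Real.casimirFun_add_half_zz`) and `Z φ = (s₁ + s₂) φ` (`Z = 1 ∈ 𝔤𝔩₂(ℝ)`). Then every central
word `z ∈ Z(𝔤)` acts on `φ` by a scalar, `z φ = θ(z) φ` for a real algebra character `θ` of the
centre (`HasZCharacter`). Proof: on `archSmooth`, the word action is the `U(𝔤)`-module structure
of `lieDerivRep` (`coe_envelopingAction_freeToEnveloping`); transport `𝔤𝔩₂(ℚ_∞) ≃ 𝔤𝔩₂(ℝ)`
(`Rat.exists_lieEquiv_lieOfReal`, `UEnv.*`, `Rat.lieDeriv_ofArch_lieOfReal_eq`); and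
`Z(U(𝔤𝔩₂)) = ℂ[Z, C]` in the form `GL2Casimir.lift_center_apply_eq_smul_of_casimir_of_zed`.
Bump 1997, §2.2 and §3.2; Borel–Jacquet 1979, 4.2 (c). [cite: BorelJacquet1979, §1.6 and 4.2 (c)] [cite: Bump1997, §2.2] -/
theorem Rat.hasZCharacter_of_casimir_of_zed {φ : (AdelicGroupData.gl 2 ℚ).Adelic → ℂ}
    (hφ : IsArchSmooth (AutomorphyDatum.gl 2 ℚ hcpt).ofArch φ) {s₁ s₂ : ℂ}
    (hC : (∑ a : Fin 2, ∑ b : Fin 2, lieDeriv Rat.iotaA (toLie (Matrix.single a b (1 : ℝ)))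
        (lieDeriv Rat.iotaA (toLie (Matrix.single b a (1 : ℝ))) φ)) = (s₁ ^ 2 + s₂ ^ 2 - 1 / 2) • φ)
    (hZ : lieDeriv Rat.iotaA (toLie 1) φ = (s₁ + s₂) • φ) :
    ∃ θ : centerU (AutomorphyDatum.gl 2 ℚ hcpt).arch →ₐ[ℝ] ℂ,
      HasZCharacter (AutomorphyDatum.gl 2 ℚ hcpt).ofArch φ θ := by
  classical
  -- the Lie action on smooth functions and its transport to `𝔤𝔩₂(ℝ)`
  have hH : (AutomorphyDatum.gl 2 ℚ hcpt).arch.lie = ⊤ := archGroupGL_lie 2 ℚ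
  have hc : (AutomorphyDatum.gl 2 ℚ hcpt).arch.carrier = ⊤ := archGroupGL_carrier 2 ℚ
  obtain ⟨e, he⟩ := Rat.exists_lieEquiv_lieOfReal hcpt
  set ρt := lieDerivRep (AutomorphyDatum.gl 2 ℚ hcpt).ofArch hH hc with hρt
  set ρM : Matrix (Fin 2) (Fin 2) ℝ →ₗ⁅ℝ⁆ Module.End ℂ (archSmooth (AutomorphyDatum.gl 2 ℚ hcpt).ofArch) :=
    ρt.comp e.toLieHom with hρM
  set v : archSmooth (AutomorphyDatum.gl 2 ℚ hcpt).ofArch := ⟨φ, hφ⟩ with hv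
  -- `ρM X ψ = X ψ` along `ι_𝔸`
  have hρM_coe : ∀ (X : Matrix (Fin 2) (Fin 2) ℝ) (ψ : archSmooth (AutomorphyDatum.gl 2 ℚ hcpt).ofArch),
      ((ρM X ψ : archSmooth (AutomorphyDatum.gl 2 ℚ hcpt).ofArch) : (AdelicGroupData.gl 2 ℚ).Adelic → ℂ) =
        lieDeriv Rat.iotaA (toLie X) ψ := by
    intro X ψ
    change ((ρt (e X) ψ : archSmooth (AutomorphyDatum.gl 2 ℚ hcpt).ofArch) : (AdelicGroupData.gl 2 ℚ).Adelic → ℂ) = _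
    rw [hρt, lieDerivRep_apply_coe, he, Rat.lieDeriv_ofArch_lieOfReal_eq]
  -- the two eigen-equations for `ρM` on `v`
  have hCM : lift ℝ ρM (casimir 2) v = (s₁ ^ 2 + s₂ ^ 2 - 1 / 2) • v := by
    apply Subtype.ext
    rw [casimir_eq_sum]
    simp only [map_sum, LinearMap.sum_apply, GL2Casimir.lift_ιU_mul_ιU_apply]
    rw [Submodule.coe_sum]
    simp only [Submodule.coe_sum, hρM_coe, Submodule.coe_smul]
    exact hC
  have hZM : lift ℝ ρM (zed 2) v = (s₁ + s₂) • v := by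
    have h1 : lift ℝ ρM (zed 2) v = ρM 1 v := by
      change lift ℝ ρM (UniversalEnvelopingAlgebra.ι ℝ (1 : Matrix (Fin 2) (Fin 2) ℝ)) v = _
      rw [lift_ι_apply]
    rw [h1]
    apply Subtype.ext
    rw [hρM_coe, Submodule.coe_smul]
    exact hZ
  -- the character of `Z(𝔤𝔩₂(ℝ))` on `v`, transported along `U(e⁻¹)`
  obtain ⟨θ₀, -, -, hθ₀⟩ := GL2Casimir.exists_character_lift_center_apply_eq_smul ρM hCM hZM
  let m : UniversalEnvelopingAlgebra ℝ (AutomorphyDatum.gl 2 ℚ hcpt).arch.lie →ₐ[ℝ]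
      UniversalEnvelopingAlgebra ℝ (Matrix (Fin 2) (Fin 2) ℝ) :=
    lift ℝ ((UniversalEnvelopingAlgebra.ι ℝ).comp e.symm.toLieHom)
  have hm : ∀ u : centerU (AutomorphyDatum.gl 2 ℚ hcpt).arch,
      m u ∈ Subalgebra.center ℝ (UniversalEnvelopingAlgebra ℝ (Matrix (Fin 2) (Fin 2) ℝ)) :=
    fun u ↦ UEnv.map_symm_mem_center e u.2
  let mZ : centerU (AutomorphyDatum.gl 2 ℚ hcpt).arch →ₐ[ℝ]
      Subalgebra.center ℝ (UniversalEnvelopingAlgebra ℝ (Matrix (Fin 2) (Fin 2) ℝ)) :=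
    (m.comp (centerU (AutomorphyDatum.gl 2 ℚ hcpt).arch).val).codRestrict _ (fun u ↦ hm u)
  refine ⟨θ₀.comp mZ, fun p hp ↦ ?_⟩
  -- `p φ = (image of p) v = U(e)(U(e⁻¹) u) v = lift ρM (U(e⁻¹) u) v = θ₀ (…) φ`
  set u : UniversalEnvelopingAlgebra ℝ (AutomorphyDatum.gl 2 ℚ hcpt).arch.lie :=
    freeToEnveloping (AutomorphyDatum.gl 2 ℚ hcpt).arch p with hu
  have h1 : applyFree (AutomorphyDatum.gl 2 ℚ hcpt).ofArch p φ =
      ((envelopingAction ρt u v : archSmooth _) : (AdelicGroupData.gl 2 ℚ).Adelic → ℂ) :=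
    (coe_envelopingAction_freeToEnveloping hH hc p v).symm
  have h2 : envelopingAction ρt u = lift ℝ ρM (m u) := by
    have hnat := UEnv.lift_comp_map e.toLieHom ρt
    -- `lift ρt u = lift ρt (U(e) (U(e⁻¹) u)) = lift (ρt ∘ e) (U(e⁻¹) u)`
    have h3 : lift ℝ ρt u = lift ℝ ρt (lift ℝ ((UniversalEnvelopingAlgebra.ι ℝ).comp e.toLieHom) (m u)) := by
      rw [UEnv.map_map_symm e u]
    change lift ℝ ρt u = _
    rw [h3, ← AlgHom.comp_apply, hnat]
  have h4 : lift ℝ ρM (m u) v = θ₀ ⟨m u, hm ⟨u, hp⟩⟩ • v := hθ₀ ⟨m u, hm ⟨u, hp⟩⟩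
  rw [h1, h2, h4, Submodule.coe_smul]
  rfl

/-- **Hence `Z(𝔤)`-finite** (`IsZFinite.of_hasZCharacter`): a smooth `φ` on `GL₂(𝔸_ℚ)` with
Casimir eigenvalue `s₁² + s₂² - ½` and central eigenvalue `s₁ + s₂` along `ι_𝔸` is
`Z(𝔤)`-finite for the `GL₂/ℚ` automorphy datum — property (c) of Borel–Jacquet 1979, 4.2 for
such `φ` (e.g. adelic lifts of holomorphic modular forms). [cite: BorelJacquet1979, §1.6 and 4.2 (c)] -/
theorem Rat.isZFinite_of_casimir_of_zed {φ : (AdelicGroupData.gl 2 ℚ).Adelic → ℂ}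
    (hφ : IsArchSmooth (AutomorphyDatum.gl 2 ℚ hcpt).ofArch φ) {s₁ s₂ : ℂ}
    (hC : (∑ a : Fin 2, ∑ b : Fin 2, lieDeriv Rat.iotaA (toLie (Matrix.single a b (1 : ℝ)))
        (lieDeriv Rat.iotaA (toLie (Matrix.single b a (1 : ℝ))) φ)) = (s₁ ^ 2 + s₂ ^ 2 - 1 / 2) • φ)
    (hZ : lieDeriv Rat.iotaA (toLie 1) φ = (s₁ + s₂) • φ) :
    IsZFinite (AutomorphyDatum.gl 2 ℚ hcpt).ofArch φ := by
  obtain ⟨θ, hθ⟩ := Rat.hasZCharacter_of_casimir_of_zed hφ hC hZ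
  exact IsZFinite.of_hasZCharacter hθ

end Main

end Literature.NumberTheory.Automorphic
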